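import Mathlib
import Summits.CriticalPhenomena.PercolationContinuityZ3.Theses.PercAxialLogConvexity
import HarnessLib

/-!
# Crux `AxialLogConvex` (stmt-CriticalPhenomena-11549) — delimiter: the crux implies axial
distance-monotonicity of the two-point function of `ℤ³` up to `p_c`

A hardness certificate for the planners (line `registered`, lead c3). The crux `AxialLogConvex`
(log-convexity of `n ↦ τ_p(0, n e₁)` on `ℤ³` for `p ≤ p_c`) implies, by a three-line real
argument that uses only `0 ≤ τ ≤ 1`, that `n ↦ τ_p(0, n e₁)` is NON-INCREASING for every
`p ≤ p_c(ℤ³)` — the axial case on `ℤ³` of the open ORDER-1 monotonicity conjecture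
(König–Richthammer, arXiv:2207.13173 = Stoch. Proc. Appl. 2025, Conjecture 1; known only for small
`p`, de Lima–Procacci–Sanchis, arXiv:1504.06549, Thm 1). So any proof of the crux proves that
conjecture along the axis up to `p_c`.

* `antitone_of_sq_le_mul_of_le` — a non-negative, bounded sequence with `a(n+1)² ≤ a(n) a(n+2)`
  is antitone (if some ratio exceeded `1`, all later ratios would, and `a` would be unbounded);
* `axialAntitone_of_AxialLogConvex` — the delimiter itself.
-/

noncomputable section

namespace Summit.CriticalPhenomena.PercolationContinuityZ3.Theorems.AxialLogConvex

open Filter Topology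

/-- **Kink-free ⇒ monotone.** A non-negative sequence bounded by `B` with
`a(n+1)² ≤ a(n)·a(n+2)` for all `n` is non-increasing: if `a(m+1) > a(m)` then `a(m) > 0`, the
ratios `a(j+1)/a(j)`, `j ≥ m`, are all at least `ρ := a(m+1)/a(m) > 1`, so `a(m+j) ≥ ρ^j a(m)`
is unbounded. [folklore] -/
theorem antitone_of_sq_le_mul_of_le (a : ℕ → ℝ) (B : ℝ) (h0 : ∀ n, 0 ≤ a n) (hB : ∀ n, a n ≤ B)
    (hlcx : ∀ n, a (n + 1) ^ 2 ≤ a n * a (n + 2)) : Antitone a := by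
  refine antitone_nat_of_succ_le fun m => ?_
  by_contra hlt
  push Not at hlt
  -- a m < a (m+1)
  have ham1 : 0 < a (m + 1) := lt_of_le_of_lt (h0 m) hlt
  have ham : 0 < a m := by
    rcases (h0 m).lt_or_eq with h | h
    · exact h
    · exfalso
      have := hlcx m
      rw [← h, zero_mul] at this
      nlinarith
  -- geometric growth: a (m + j + 1) * a m ≥ a (m + 1) * a (m + j), and positivity, by induction
  have key : ∀ j : ℕ, 0 < a (m + j) ∧ a (m + 1) * a (m + j) ≤ a m * a (m + j + 1) := by
    intro j
    induction j with
    | zero => exact ⟨by simpa using ham, by simp [mul_comm]⟩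
    | succ j ih =>
      obtain ⟨hpos, hrat⟩ := ih
      have hpos' : 0 < a (m + j + 1) := by
        -- from hrat: a(m+1) a(m+j) ≤ a m a(m+j+1), lhs > 0
        have : 0 < a m * a (m + j + 1) := lt_of_lt_of_le (mul_pos ham1 hpos) hrat
        exact (pos_iff_pos_of_mul_pos this).mp ham
      refine ⟨by simpa [Nat.add_assoc] using hpos', ?_⟩
      -- want: a(m+1) a(m+j+1) ≤ a m a(m+j+2); use lcx at m+j: a(m+j+1)^2 ≤ a(m+j) a(m+j+2)
      have hl := hlcx (m + j)
      -- a(m+1)/a(m) ≤ a(m+j+1)/a(m+j) ≤ a(m+j+2)/a(m+j+1)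
      show a (m + 1) * a (m + j + 1) ≤ a m * a (m + j + 2)
      -- multiply: (a(m+1) a(m+j+1)) * a(m+j) ≤ a m * a(m+j+1) * a(m+j+1) ≤ a m a(m+j) a(m+j+2)... careful
      have hA : a (m + 1) * a (m + j + 1) * a (m + j) ≤ a m * a (m + j + 1) ^ 2 := by
        have := mul_le_mul_of_nonneg_right hrat (h0 (m + j + 1))
        nlinarith
      have hB' : a m * a (m + j + 1) ^ 2 ≤ a m * (a (m + j) * a (m + j + 2)) :=
        mul_le_mul_of_nonneg_left hl (h0 m)
      have hC : a (m + 1) * a (m + j + 1) * a (m + j) ≤ a m * a (m + j + 2) * a (m + j) := by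
        nlinarith
      exact le_of_mul_le_mul_right hC hpos
  -- hence a(m+j) ≥ ρ^j a(m) with ρ = a(m+1)/a(m) > 1: unbounded
  set ρ : ℝ := a (m + 1) / a m with hρ
  have hρ1 : 1 < ρ := by rw [hρ, one_lt_div ham]; exact hlt
  have grow : ∀ j : ℕ, ρ ^ j * a m ≤ a (m + j) := by
    intro j
    induction j with
    | zero => simp
    | succ j ih =>
      obtain ⟨hpos, hrat⟩ := key j
      have : ρ * a (m + j) ≤ a (m + j + 1) := by
        rw [hρ, div_mul_eq_mul_div, div_le_iff₀ ham]
        linarith [hrat, mul_comm (a m) (a (m + j + 1))]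
      calc ρ ^ (j + 1) * a m = ρ * (ρ ^ j * a m) := by ring
        _ ≤ ρ * a (m + j) := mul_le_mul_of_nonneg_left ih (by linarith)
        _ ≤ a (m + (j + 1)) := by simpa [Nat.add_assoc] using this
  -- pick j with ρ^j > B / a m
  obtain ⟨j, hj⟩ := pow_unbounded_of_one_lt (B / a m) hρ1
  have : B < a (m + j) := by
    have h1 : B < ρ ^ j * a m := by rwa [div_lt_iff₀ ham] at hj
    exact h1.trans_le (grow j)
  exact absurd (hB (m + j)) (not_le.2 this)

/-- **Delimiter (hardness of the crux).** `AxialLogConvex` implies that for every `p ≤ p_c(ℤ³)`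
the axial two-point function `n ↦ τ_p(0, n e₁)` of bond percolation on `ℤ³` is non-increasing in
the distance `n` — the axial `ℤ³` case, up to `p_c`, of the open distance-monotonicity conjecture
(König–Richthammer 2025, Conj. 1; for small `p` only: de Lima–Procacci–Sanchis 2015, Thm 1).
[folklore reduction; cite: KonigRichthammer2025 Conj. 1; arXiv:1504.06549 Thm 1] -/
theorem axialAntitone_of_AxialLogConvex :
    Summit.CriticalPhenomena.PercolationContinuityZ3.Theses.PercAxialLogConvexity.AxialLogConvex →
      ∀ p : unitInterval, p ≤ Literature.Probability.Percolation.criticalProbI 3 →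
        Antitone (fun n : ℕ => Literature.Probability.Percolation.tau 3 p 0 (Pi.single 0 (n : ℤ))) := by
  intro hLCX p hp
  refine antitone_of_sq_le_mul_of_le _ 1 (fun n => Literature.Probability.Percolation.tau_nonneg _ _ _)
    (fun n => Literature.Probability.Percolation.tau_le_one _ _ _) fun n => ?_
  simpa using hLCX p hp n

end Summit.CriticalPhenomena.PercolationContinuityZ3.Theorems.AxialLogConvex

end
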